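import Summits.NavierStokesRegularity.NavierStokesRegularity.Theses.HodographBetchov

/-!
# Route HodographBetchov — `Assembly` (item stmt-NavierStokesRegularity-16864)

Pure logic: the crux-only chain of the route `HodographBetchov`,

  `SlowClassProduction → FastClassSqueeze → ClassBudgetsRegularise → NavierStokesRegularity`,

is, hypothesis for hypothesis, the type of the route's deciding theorem
`Summit.NavierStokesRegularity.NavierStokesRegularity.Theses.HodographBetchov.closes` (rev 3).
The proof below is self-contained (it does not invoke `closes`), so that it depends only on the
item definitions.

Argument. Clay (A) datum by datum: the bridge crux `ClassBudgetsRegularise` asks, along every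
classical Leray–Hopf solution `(u, p)` on `ℝ³ × [0,T)` with `u 0 = u₀`, for ONE speed level `l > 0`
carrying both the slow-class production bound and the fast-class squeeze. `FastClassSqueeze`
supplies such a level `l` together with the squeeze, and `SlowClassProduction` holds at every
level, in particular at `l`; the rapid decay of `u 0` is that of `u₀` transported along `u 0 = u₀`.
Nothing here is new mathematics; the open content lives in the three cruxes.
-/

set_option linter.dupNamespace false

namespace Summit.NavierStokesRegularity.NavierStokesRegularity.Theorems

open Summit.NavierStokesRegularity.NavierStokesRegularity.Theses.HodographBetchov

/-- **Assembly** (item stmt-NavierStokesRegularity-16864, route HodographBetchov):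
`SlowClassProduction → FastClassSqueeze → ClassBudgetsRegularise → NavierStokesRegularity` —
pure logic: for each Clay datum `u₀` the bridge `ClassBudgetsRegularise` needs one speed level
carrying both class budgets along every classical Leray–Hopf solution from `u₀`;
`FastClassSqueeze` supplies the level and the squeeze, `SlowClassProduction` the slow-class
bound at that level. [folklore] -/
theorem hodographBetchov_assembly_proof :
    Summit.NavierStokesRegularity.NavierStokesRegularity.Theses.HodographBetchov.Assembly := by
  unfold Assembly
  intro h₁ h₂ h₃ ν hν u₀ hs hd hdec
  refine h₃ ν hν u₀ hs hd hdec ?_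
  intro T hT u p hcl hLH h0
  have hdec0 : Literature.Analysis.FluidPDE.HasRapidSpatialDecay (u 0) := h0 ▸ hdec
  obtain ⟨l, hl, hF⟩ := h₂ ν T hν hT u p hcl hLH hdec0
  exact ⟨l, hl, h₁ ν T hν hT u p hcl hLH hdec0 l hl, hF⟩

end Summit.NavierStokesRegularity.NavierStokesRegularity.Theorems
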